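import Summits.AtomisticToContinuum.Crystallization.Theorems.FrustratedLawDichotomyStrainedPatchHomConvexSegment

/-!
# (C′-2) FORCE/EXEMPT PRUNE, centred form — the one-dimensional SECOND-ORDER lemma behind `…HomForceCentred`
# (27623 strained-patch piece, hcp half; decomp-a2c hand-2 g28)

For one lattice term of the one-atom move slope, `g(v) = Φ(‖τe − v‖²)·⟪τe − v, e⟫` with `Φ(x) = x⁻⁴ − x⁻⁷`, the centred leaf uses

  `g(v⁰ + d) ≤ g(v⁰) + W·d + K/2`,  `W = −(2Φ′(Q⁰)⟪r⁰, e⟫ r⁰ + Φ(Q⁰) e)`,  `r⁰ = τe − v⁰`, `Q⁰ = ‖r⁰‖²`,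

whenever `K` dominates `|γ″|` on `[0, 1]`, `γ(t) = g(v⁰ + t d) = Φ(Q_t) L_t` with the QUADRATIC `Q_t = ‖r⁰ − t d‖² = Q⁰ − 2t⟪r⁰,d⟫ + t²‖d‖²` and the
LINEAR `L_t = ⟪r⁰,e⟫ − t⟪d,e⟫`:  `γ″ = Φ″(Q)Q′²L + Φ′(Q)·2‖d‖²·L + 2Φ′(Q)Q′L′`, `Q′ = −2⟪r⁰ − td, d⟫`, `L′ = −⟪d, e⟫`.

* §1 `secondOrder_upper` — `f(1) ≤ f(0) + f′(0) + K/2` from `|f″| ≤ K` on `[0,1]` (mean value theorem on `f′`, then monotonicity of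
  `t ↦ f(0) + t f′(0) + (K/2)t² − f(t)` by `…HomConvexSegment.le_of_deriv_nonneg_piece`);
* §2 `hasDerivAt_inv_pow_succ`, the derivatives of `Φ` and `Φ′` (`Φ′ = 7u⁸ − 4u⁵`, `Φ″ = 20u⁶ − 56u⁹`, `u = x⁻¹`);
* §3 ★ `path_secondOrder` — the displayed inequality for the scalar data `(Q⁰, ⟪r⁰,d⟫, ‖d‖², ⟪r⁰,e⟫, ⟪d,e⟫)` with `K` bounding the three-term
  magnitude form `4|Φ″|⟪r_t,d⟫²|L_t| + 2|Φ′|‖d‖²|L_t| + 4|Φ′||⟪r_t,d⟫||⟪d,e⟫|`, `norm_sq_path` / `inner_path`, and ★★ `term_secondOrder` — the same in vector form on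
  `E3`, first-order part written as `Σ_a W_a d_a` (the shape the kernel accumulates).
NO definitions; 0 sorry; axioms standard.  `--supports stmt-AtomisticToContinuum-27623`.
-/

namespace Summit.AtomisticToContinuum.Crystallization.Theorems.FrustratedLawDichotomyStrainedPatchHomForceCentredPath

open scoped BigOperators RealInnerProductSpace
open Summit.AtomisticToContinuum.Crystallization.Theorems.ChargedEnergyGapNegative (E3)
open Summit.AtomisticToContinuum.Crystallization.Theorems.FrustratedLawDichotomyStrainedPatchHomConvexSegment (le_of_deriv_nonneg_piece)

/-! ## §1. Second-order upper bound on `[0, 1]` -/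

/-- ★ `|f″| ≤ K` on `[0,1]` (with `f′`, `f″` honest derivatives there) ⟹ `f(1) ≤ f(0) + f′(0) + K/2`. [folklore: Taylor with Lagrange remainder] -/
theorem secondOrder_upper {f f' f'' : ℝ → ℝ} {K : ℝ} (hf : ∀ t ∈ Set.Icc (0 : ℝ) 1, HasDerivAt f (f' t) t)
    (hf' : ∀ t ∈ Set.Icc (0 : ℝ) 1, HasDerivAt f' (f'' t) t) (hK : ∀ t ∈ Set.Icc (0 : ℝ) 1, |f'' t| ≤ K) :
    f 1 ≤ f 0 + f' 0 + K / 2 := by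
  -- the slope of `f′` on `[0, t]`
  have slope : ∀ t ∈ Set.Ioo (0 : ℝ) 1, f' t - f' 0 ≤ K * t := by
    intro t ht
    have hcont : ContinuousOn f' (Set.Icc 0 t) := fun x hx =>
      (hf' x ⟨hx.1, hx.2.trans ht.2.le⟩).continuousAt.continuousWithinAt
    obtain ⟨c, hc, hcd⟩ := exists_hasDerivAt_eq_slope f' f'' ht.1 hcont (fun x hx => hf' x ⟨hx.1.le, hx.2.le.trans ht.2.le⟩)
    have hKc := hK c ⟨hc.1.le, hc.2.le.trans ht.2.le⟩
    have ht0 : t ≠ 0 := ht.1.ne'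
    have h1 : f' t - f' 0 = f'' c * t := by
      rw [hcd, sub_zero, div_mul_cancel₀ _ ht0]
    rw [h1]
    exact mul_le_mul_of_nonneg_right ((le_abs_self _).trans hKc) ht.1.le
  have hcontf : ContinuousOn (fun t => f 0 + t * f' 0 + K / 2 * t ^ 2 - f t) (Set.Icc 0 1) := by
    intro x hx
    have hfx := (hf x hx).continuousAt
    exact ((((continuousAt_const.add (continuousAt_id.mul continuousAt_const)).add
      (continuousAt_const.mul (continuousAt_id.pow 2))).sub hfx)).continuousWithinAt
  have hder : ∀ t ∈ Set.Ioo (0 : ℝ) 1,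
      HasDerivAt (fun t => f 0 + t * f' 0 + K / 2 * t ^ 2 - f t) (f' 0 + K * t - f' t) t := by
    intro t ht
    have h := ((((hasDerivAt_id t).mul_const (f' 0)).const_add (f 0)).add ((hasDerivAt_pow 2 t).const_mul (K / 2))).sub
      (hf t ⟨ht.1.le, ht.2.le⟩)
    refine h.congr_deriv ?_
    simp only [Nat.cast_ofNat]
    ring
  have hmono := le_of_deriv_nonneg_piece (h := fun t => f 0 + t * f' 0 + K / 2 * t ^ 2 - f t) zero_le_one hcontf hder
    (fun t ht => by have := slope t ht; linarith)
  simp only [zero_mul, add_zero, ne_eq, OfNat.ofNat_ne_zero, not_false_eq_true, zero_pow, mul_zero, sub_self, one_mul, one_pow,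
    mul_one] at hmono
  linarith

/-! ## §2. Derivatives of `Φ(x) = x⁻⁴ − x⁻⁷` -/

/-- `d/dx (x⁻¹)^(n+1) = −(n+1)(x⁻¹)^(n+2)` (`x ≠ 0`). [folklore] -/
theorem hasDerivAt_inv_pow_succ (n : ℕ) {x : ℝ} (hx : x ≠ 0) :
    HasDerivAt (fun y : ℝ => y⁻¹ ^ (n + 1)) (-((n : ℝ) + 1) * x⁻¹ ^ (n + 2)) x := by
  have h := (hasDerivAt_inv hx).pow (n + 1)
  refine h.congr_deriv ?_
  rw [Nat.add_sub_cancel, ← inv_pow]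
  push_cast
  ring

/-- `Φ′`: `d/dx (x⁻⁴ − x⁻⁷) = 7(x⁻¹)⁸ − 4(x⁻¹)⁵`. [folklore] -/
theorem hasDerivAt_phi {x : ℝ} (hx : x ≠ 0) :
    HasDerivAt (fun y : ℝ => y⁻¹ ^ 4 - y⁻¹ ^ 7) (7 * x⁻¹ ^ 8 - 4 * x⁻¹ ^ 5) x := by
  have h := (hasDerivAt_inv_pow_succ 3 hx).sub (hasDerivAt_inv_pow_succ 6 hx)
  refine h.congr_deriv ?_
  push_cast
  ring

/-- `Φ″`: `d/dx (7x⁻⁸ − 4x⁻⁵) = 20(x⁻¹)⁶ − 56(x⁻¹)⁹`. [folklore] -/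
theorem hasDerivAt_phi' {x : ℝ} (hx : x ≠ 0) :
    HasDerivAt (fun y : ℝ => 7 * y⁻¹ ^ 8 - 4 * y⁻¹ ^ 5) (20 * x⁻¹ ^ 6 - 56 * x⁻¹ ^ 9) x := by
  have h := ((hasDerivAt_inv_pow_succ 7 hx).const_mul 7).sub ((hasDerivAt_inv_pow_succ 4 hx).const_mul 4)
  refine h.congr_deriv ?_
  push_cast
  ring

/-! ## §3. The second-order bound of one term along the displacement segment -/

/-- ★ **SCALAR FORM.**  Data `A = Q⁰`, `B = ⟪r⁰,d⟫`, `C = ‖d‖²`, `L₀ = ⟪r⁰,e⟫`, `L₁ = ⟪d,e⟫`; `Q_t = A − 2Bt + Ct² > 0` on `[0,1]`; `K` dominates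
`4|Φ″(Q_t)|·(B − Ct)²·|L_t| + 2|Φ′(Q_t)|·C·|L_t| + 4|Φ′(Q_t)|·|B − Ct|·|L₁|` (`L_t = L₀ − L₁t`, `0 ≤ C`).  Then
`Φ(Q₁)L₁' ≤ Φ(A)L₀ + (Φ′(A)(−2B)L₀ + Φ(A)(−L₁)) + K/2` (`Q₁ = A − 2B + C`, `L₁' = L₀ − L₁`). [folklore] -/
theorem path_secondOrder {A B C L0 L1 K : ℝ} (hC : 0 ≤ C) (hQ : ∀ t ∈ Set.Icc (0 : ℝ) 1, 0 < A - 2 * B * t + C * t ^ 2)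
    (hK : ∀ t ∈ Set.Icc (0 : ℝ) 1,
      4 * |20 * (A - 2 * B * t + C * t ^ 2)⁻¹ ^ 6 - 56 * (A - 2 * B * t + C * t ^ 2)⁻¹ ^ 9| * (B - C * t) ^ 2 * |L0 - L1 * t| +
      2 * |7 * (A - 2 * B * t + C * t ^ 2)⁻¹ ^ 8 - 4 * (A - 2 * B * t + C * t ^ 2)⁻¹ ^ 5| * C * |L0 - L1 * t| +
      4 * |7 * (A - 2 * B * t + C * t ^ 2)⁻¹ ^ 8 - 4 * (A - 2 * B * t + C * t ^ 2)⁻¹ ^ 5| * |B - C * t| * |L1| ≤ K) :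
    ((A - 2 * B + C)⁻¹ ^ 4 - (A - 2 * B + C)⁻¹ ^ 7) * (L0 - L1) ≤
      (A⁻¹ ^ 4 - A⁻¹ ^ 7) * L0 + ((7 * A⁻¹ ^ 8 - 4 * A⁻¹ ^ 5) * (-2 * B) * L0 + (A⁻¹ ^ 4 - A⁻¹ ^ 7) * (-L1)) + K / 2 := by
  -- the path functions
  set Q : ℝ → ℝ := fun t => A - 2 * B * t + C * t ^ 2 with hQdef
  set f : ℝ → ℝ := fun t => ((Q t)⁻¹ ^ 4 - (Q t)⁻¹ ^ 7) * (L0 - L1 * t) with hfdef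
  set f' : ℝ → ℝ := fun t => (7 * (Q t)⁻¹ ^ 8 - 4 * (Q t)⁻¹ ^ 5) * (-2 * B + 2 * C * t) * (L0 - L1 * t) +
    ((Q t)⁻¹ ^ 4 - (Q t)⁻¹ ^ 7) * (-L1) with hf'def
  set f'' : ℝ → ℝ := fun t => (20 * (Q t)⁻¹ ^ 6 - 56 * (Q t)⁻¹ ^ 9) * (-2 * B + 2 * C * t) ^ 2 * (L0 - L1 * t) +
    (7 * (Q t)⁻¹ ^ 8 - 4 * (Q t)⁻¹ ^ 5) * (2 * C) * (L0 - L1 * t) +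
    2 * ((7 * (Q t)⁻¹ ^ 8 - 4 * (Q t)⁻¹ ^ 5) * (-2 * B + 2 * C * t) * (-L1)) with hf''def
  have hQder : ∀ t, HasDerivAt Q (-2 * B + 2 * C * t) t := by
    intro t
    have h := (((hasDerivAt_id t).const_mul (2 * B)).const_sub A).add ((hasDerivAt_pow 2 t).const_mul C)
    refine h.congr_deriv ?_
    simp only [Nat.cast_ofNat]
    ring
  have hLder : ∀ t, HasDerivAt (fun t : ℝ => L0 - L1 * t) (-L1) t := by
    intro t
    have h := ((hasDerivAt_id t).const_mul L1).const_sub L0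
    refine h.congr_deriv ?_
    simp
  have hf : ∀ t ∈ Set.Icc (0 : ℝ) 1, HasDerivAt f (f' t) t := by
    intro t ht
    have hQt : Q t ≠ 0 := (hQ t ht).ne'
    have h := ((hasDerivAt_phi hQt).comp t (hQder t)).mul (hLder t)
    refine h.congr_deriv ?_
    simp only [hf'def, Function.comp_apply]
  have hf' : ∀ t ∈ Set.Icc (0 : ℝ) 1, HasDerivAt f' (f'' t) t := by
    intro t ht
    have hQt : Q t ≠ 0 := (hQ t ht).ne'
    have hQ'der : HasDerivAt (fun t : ℝ => -2 * B + 2 * C * t) (2 * C) t := by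
      have h := ((hasDerivAt_id t).const_mul (2 * C)).const_add (-2 * B)
      refine h.congr_deriv ?_
      simp
    have h1 := (((hasDerivAt_phi' hQt).comp t (hQder t)).mul hQ'der).mul (hLder t)
    have h2 := ((hasDerivAt_phi hQt).comp t (hQder t)).mul_const (-L1)
    have h := h1.add h2
    refine h.congr_deriv ?_
    simp only [hf''def, Function.comp_apply, Pi.mul_apply]; ring
  have hKf : ∀ t ∈ Set.Icc (0 : ℝ) 1, |f'' t| ≤ K := by
    intro t ht
    refine le_trans ?_ (hK t ht)
    simp only [hf''def]
    have e1 : (-2 * B + 2 * C * t) ^ 2 = 4 * (B - C * t) ^ 2 := by ring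
    rw [e1]
    refine (abs_add_le _ _).trans (add_le_add ((abs_add_le _ _).trans (add_le_add ?_ ?_)) ?_)
    · rw [abs_mul, abs_mul, abs_of_nonneg (by positivity : (0 : ℝ) ≤ 4 * (B - C * t) ^ 2)]
      apply le_of_eq; ring
    · rw [abs_mul, abs_mul, abs_of_nonneg (by positivity : (0 : ℝ) ≤ 2 * C)]
      apply le_of_eq; ring
    · rw [abs_mul, abs_mul, abs_mul, abs_neg, show |(2 : ℝ)| = 2 by norm_num]
      have e2 : |-2 * B + 2 * C * t| = 2 * |B - C * t| := by
        rw [show -2 * B + 2 * C * t = (-2) * (B - C * t) by ring, abs_mul]; norm_num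
      rw [e2]
      apply le_of_eq; ring
  have hmain := secondOrder_upper hf hf' hKf
  have e0 : Q 0 = A := by simp [hQdef]
  have e1 : Q 1 = A - 2 * B + C := by simp [hQdef]
  simp only [hfdef, hf'def, e0, e1, mul_zero, sub_zero, mul_one, add_zero] at hmain
  linarith

/-- `‖r⁰ − t d‖² = ‖r⁰‖² − 2t⟪r⁰,d⟫ + t²‖d‖²`. [arithmetic] -/
theorem norm_sq_path (r0 d : E3) (t : ℝ) : ‖r0 - t • d‖ ^ 2 = ‖r0‖ ^ 2 - 2 * ⟪r0, d⟫ * t + ‖d‖ ^ 2 * t ^ 2 := by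
  rw [norm_sub_sq_real, inner_smul_right, norm_smul, mul_pow, Real.norm_eq_abs, sq_abs]
  ring

/-- `⟪r⁰ − t d, x⟫ = ⟪r⁰, x⟫ − t⟪d, x⟫`. [arithmetic] -/
theorem inner_path (r0 d x : E3) (t : ℝ) : ⟪r0 - t • d, x⟫ = ⟪r0, x⟫ - ⟪d, x⟫ * t := by
  rw [inner_sub_left, inner_smul_left]; simp; ring

/-- ★★ **VECTOR FORM (the shape the kernel certifies).**  For `r⁰, d, e : E3` with `r⁰ − t d ≠ 0` on `[0,1]` and `K` dominating
`4|Φ″(Q_t)|⟪r_t,d⟫²|⟪r_t,e⟫| + 2|Φ′(Q_t)|‖d‖²|⟪r_t,e⟫| + 4|Φ′(Q_t)||⟪r_t,d⟫||⟪d,e⟫|` (`r_t = r⁰ − td`, `Q_t = ‖r_t‖²`):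
`Φ(‖r⁰ − d‖²)⟪r⁰ − d, e⟫ ≤ Φ(‖r⁰‖²)⟪r⁰, e⟫ + Σ_a W_a d_a + K/2`, `W_a = −(2Φ′(Q⁰)⟪r⁰,e⟫ r⁰_a + Φ(Q⁰) e_a)`. [folklore] -/
theorem term_secondOrder (r0 d e : E3) {K : ℝ} (hpos : ∀ t ∈ Set.Icc (0 : ℝ) 1, r0 - t • d ≠ 0)
    (hK : ∀ t ∈ Set.Icc (0 : ℝ) 1,
      4 * |20 * (‖r0 - t • d‖ ^ 2)⁻¹ ^ 6 - 56 * (‖r0 - t • d‖ ^ 2)⁻¹ ^ 9| * ⟪r0 - t • d, d⟫ ^ 2 * |⟪r0 - t • d, e⟫| +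
      2 * |7 * (‖r0 - t • d‖ ^ 2)⁻¹ ^ 8 - 4 * (‖r0 - t • d‖ ^ 2)⁻¹ ^ 5| * ‖d‖ ^ 2 * |⟪r0 - t • d, e⟫| +
      4 * |7 * (‖r0 - t • d‖ ^ 2)⁻¹ ^ 8 - 4 * (‖r0 - t • d‖ ^ 2)⁻¹ ^ 5| * |⟪r0 - t • d, d⟫| * |⟪d, e⟫| ≤ K) :
    ((‖r0 - d‖ ^ 2)⁻¹ ^ 4 - (‖r0 - d‖ ^ 2)⁻¹ ^ 7) * ⟪r0 - d, e⟫ ≤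
      ((‖r0‖ ^ 2)⁻¹ ^ 4 - (‖r0‖ ^ 2)⁻¹ ^ 7) * ⟪r0, e⟫ +
      ∑ a : Fin 3, -(2 * (7 * (‖r0‖ ^ 2)⁻¹ ^ 8 - 4 * (‖r0‖ ^ 2)⁻¹ ^ 5) * ⟪r0, e⟫ * r0 a + ((‖r0‖ ^ 2)⁻¹ ^ 4 - (‖r0‖ ^ 2)⁻¹ ^ 7) * e a) * d a +
      K / 2 := by
  have hC : (0 : ℝ) ≤ ‖d‖ ^ 2 := by positivity
  have hQ : ∀ t ∈ Set.Icc (0 : ℝ) 1, 0 < ‖r0‖ ^ 2 - 2 * ⟪r0, d⟫ * t + ‖d‖ ^ 2 * t ^ 2 := by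
    intro t ht; rw [← norm_sq_path]; exact pow_pos (norm_pos_iff.2 (hpos t ht)) 2
  have hK' : ∀ t ∈ Set.Icc (0 : ℝ) 1,
      4 * |20 * (‖r0‖ ^ 2 - 2 * ⟪r0, d⟫ * t + ‖d‖ ^ 2 * t ^ 2)⁻¹ ^ 6 - 56 * (‖r0‖ ^ 2 - 2 * ⟪r0, d⟫ * t + ‖d‖ ^ 2 * t ^ 2)⁻¹ ^ 9| *
          (⟪r0, d⟫ - ‖d‖ ^ 2 * t) ^ 2 * |⟪r0, e⟫ - ⟪d, e⟫ * t| +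
      2 * |7 * (‖r0‖ ^ 2 - 2 * ⟪r0, d⟫ * t + ‖d‖ ^ 2 * t ^ 2)⁻¹ ^ 8 - 4 * (‖r0‖ ^ 2 - 2 * ⟪r0, d⟫ * t + ‖d‖ ^ 2 * t ^ 2)⁻¹ ^ 5| *
          ‖d‖ ^ 2 * |⟪r0, e⟫ - ⟪d, e⟫ * t| +
      4 * |7 * (‖r0‖ ^ 2 - 2 * ⟪r0, d⟫ * t + ‖d‖ ^ 2 * t ^ 2)⁻¹ ^ 8 - 4 * (‖r0‖ ^ 2 - 2 * ⟪r0, d⟫ * t + ‖d‖ ^ 2 * t ^ 2)⁻¹ ^ 5| *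
          |⟪r0, d⟫ - ‖d‖ ^ 2 * t| * |⟪d, e⟫| ≤ K := by
    intro t ht
    have h := hK t ht
    have e1 : ⟪r0 - t • d, d⟫ = ⟪r0, d⟫ - ‖d‖ ^ 2 * t := by rw [inner_path, real_inner_self_eq_norm_sq]
    rw [norm_sq_path, inner_path r0 d e, e1] at h
    exact h
  have hmain := path_secondOrder (L0 := ⟪r0, e⟫) (L1 := ⟪d, e⟫) hC hQ hK'
  have e2 : ‖r0 - d‖ ^ 2 = ‖r0‖ ^ 2 - 2 * ⟪r0, d⟫ + ‖d‖ ^ 2 := by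
    have := norm_sq_path r0 d 1; simp at this; linarith [this]
  have e3 : ⟪r0 - d, e⟫ = ⟪r0, e⟫ - ⟪d, e⟫ := by rw [inner_sub_left]
  rw [e2, e3]
  have e4 : ∑ a : Fin 3, -(2 * (7 * (‖r0‖ ^ 2)⁻¹ ^ 8 - 4 * (‖r0‖ ^ 2)⁻¹ ^ 5) * ⟪r0, e⟫ * r0 a +
        ((‖r0‖ ^ 2)⁻¹ ^ 4 - (‖r0‖ ^ 2)⁻¹ ^ 7) * e a) * d a =
      (7 * (‖r0‖ ^ 2)⁻¹ ^ 8 - 4 * (‖r0‖ ^ 2)⁻¹ ^ 5) * (-2 * ⟪r0, d⟫) * ⟪r0, e⟫ + ((‖r0‖ ^ 2)⁻¹ ^ 4 - (‖r0‖ ^ 2)⁻¹ ^ 7) * (-⟪d, e⟫) := by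
    -- `⟪x, y⟫ = Σ_a x_a y_a` (the tree's `inner_fin3`, inlined to keep the import light)
    have inner3 : ∀ x y : E3, ⟪x, y⟫ = x 0 * y 0 + x 1 * y 1 + x 2 * y 2 := fun x y => by
      rw [real_inner_comm, ← (EuclideanSpace.equiv (Fin 3) ℝ).symm_apply_apply x, ← (EuclideanSpace.equiv (Fin 3) ℝ).symm_apply_apply y]
      simp [EuclideanSpace.inner_eq_star_dotProduct, dotProduct, Fin.sum_univ_three]
    rw [Fin.sum_univ_three, inner3 r0 d, inner3 d e]
    ring
  rw [e4]
  exact hmain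

end Summit.AtomisticToContinuum.Crystallization.Theorems.FrustratedLawDichotomyStrainedPatchHomForceCentredPath
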